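import Summits.QuantumFields.YangMills.Theorems.BalabanUVNodesK0RecordFormatNamesLemmas2
import Summits.QuantumFields.YangMills.Theorems.BalabanUVNodesN07RecordDomainsAdm22
import Summits.QuantumFields.YangMills.Theorems.BalabanUVNodesN21OnCubeCount
import Literature.MathematicalPhysics.QuantumFieldTheory.Balaban1983to89.B12Decay510Torus
import Literature.MathematicalPhysics.QuantumFieldTheory.Balaban1983to89.Node00.TwoRunSiteTransport

/-!
# PORT PT-B (U8), file 2 — the TWO-VOLUME GEOMETRY of (1.21) at the record's CENTRED layer, part 1: tiled range, fine cube index of a site, centred lift of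
# sites versus centred lift of cubes, and THE OFF-SEAM LEMMA (`recordDomEmbCtr X` IS the lifted cube family for `X ∉ recordWrapCtr`)

Cell `ym-nodeO-ideate` ∕ `ym-balaban-port`, porter `ymgap-nodeO-port-PTB-1` (gen 0), item **stmt-QuantumFields-27931** `BalabanUVNodes.PortPieceLocalityU8` (string ⁶
`nodeO-cover/TYPER-Sig27931-v6-J.txt`, sha16 `3e2971674efa3b12`); PORT-PLAN-v1 row U8-2V (d205bbafa0327b26); `--kind proof --supports stmt-QuantumFields-27931` (helper).
[I] = [Balaban1987RG1].  CONSUMED BY NAME: DEF-1's names (`recordDomSys ∕ recordK₀ ∕ McGuard ∕ liftSiteCtr ∕ liftCubeCtr ∕ OnSeamCtr ∕ recordWrapCtr ∕ recordDomEmbCtr`,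
`domCount_mul_side_eq`, `pow_mul_dvd_sitesPerDir`), 11b's `Sect2.domSites ∕ domCount ∕ liftIdx`, `N07RecordDomainsAdm22.mem_cubeEnl_zero_iff_cubeIdx`,
`N21OnCubeCount.mem_cubeIndices_iff`, `TreeLengthTorus` (`TAdj ∕ TLinked ∕ IsTDom`), Mathlib's `ZMod.valMinAbs`.  Part 2 (`BalabanUVNodesPortU8Response9`) derives rows (R3)∕(R5).
WHAT THIS FILE PROVES (theorems only; no `def ∕ instance ∕ notation ∕ sorry`; standard axioms; `K ≥ recordK₀ F Mc k`, `s = L^{k+1}·Mc`, `q = domCount`, `n₀ = 2L^{m+K}`):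
§1 `q·s = n₀`, `q = n₀∕s`, `n₀(K+1) = L·n₀(K)` (11b's `sitesPerDir_zero_succ`), `q(K+1) = L·q(K)`, `q` EVEN, `n₀∕2 = s·(q∕2)`.  §2 ★ `mem_domSites_iff` — a fine site lies in `domSites X` iff its cube index
`(⌊x_i∕s⌋)_i` (on the index torus) is a cube of `X`.  §3 `val_liftSiteCtr_of_le ∕ _of_lt` (lifted value `v` ∕ `(L−1)n₀ + v`), ★ `cube_liftSiteCtr` (off the antipodal cube layer the
cube of the lifted site IS the centred lift of the cube), ★ `cube_eq_of_liftSiteCtr` (conversely, for ANY site), `valMinAbs_add_one_of_ne_half`.  §4 ★★ THE OFF-SEAM LEMMA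
`isTDom_image_liftCubeCtr` (for `X ∉ recordWrapCtr` the lifted family is non-empty and wall-connected) ⇒ ★ `recordDomEmbCtr_val` (the definition's first branch; ref-H's nit on (R3)).
HONEST FRAMING.  Index bookkeeping about DEF-1's two-volume names; nothing of Bałaban's analysis ((1.21)'s limit, [15] Prop. 9, rows (R1ᴰ)∕(R4ᴰ), the ι-row's `C²` clause) is
asserted, ported or discharged; 27931⁶ OPEN; K0⁷ NOT closed; NODE O 0∕1; COUNT 8∕28 · K 1∕4 UNMOVED; finite `𝕋⁴_{L^K}` at fixed ε — NOT continuum ∕ OS ∕ Clay; **the Yang–Mills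
mass gap (Clay) is NOT proved by any of this.**
-/

noncomputable section

open scoped BigOperators Matrix.Norms.L2Operator

namespace Summit.QuantumFields.YangMills.Theorems.PortU8

open Literature.MathematicalPhysics.QuantumFieldTheory.Balaban1983to89
open Literature.MathematicalPhysics.QuantumFieldTheory.Balaban1983to89.Node00
open Literature.MathematicalPhysics.QuantumFieldTheory.Balaban1983to89.T4Continuum (T4Family)
open Literature.MathematicalPhysics.QuantumFieldTheory.Balaban1983to89.TreeLengthTorus (TPt IsTDom TFaceConnected TLinked TStepIn TAdj)
open Literature.MathematicalPhysics.QuantumFieldTheory.Balaban1983to89.B15Eq112TorusCover (lift)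
open Literature.MathematicalPhysics.QuantumFieldTheory.Balaban1983to89.B14DomainGeom (cubeIdx)
open Literature.MathematicalPhysics.QuantumFieldTheory.Balaban1983to89.B14.Eq213MaximalDomains (side)
open Summit.QuantumFields.YangMills.Theorems.K0RecordFormatNames
open Summit.QuantumFields.YangMills.BalabanUVNodes.N07RecordDomainsAdm22 (mem_cubeEnl_zero_iff_cubeIdx)
open Summit.QuantumFields.YangMills.Theorems.N21OnCubeCount (mem_cubeIndices_iff)
variable (F : T4Family)

/-! ## §1  Arithmetic of the exactly-tiled range `K ≥ recordK₀ F Mc k` -/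

/-- The cube side of `𝐃_{k+1}` in fine sites is positive. [cite: Balaban1987RG1, p.257 (bookkeeping)] -/
theorem side_pos (Mc k K : ℕ) (hMc : McGuard F Mc) : 0 < side (F.P K).L Mc (k + 1) := by
  obtain ⟨c, rfl⟩ := hMc
  have hL : 0 < F.L := by have := F.hL.2; omega
  unfold side
  exact Nat.mul_pos (pow_pos hL _) (pow_pos hL _)

variable {F} in
/-- On the tiled range the cube side divides the torus side. [cite: Balaban1987RG1, p.257 (the cubes π_j tile the torus)] -/
theorem side_dvd_sitesPerDir {Mc k K : ℕ} (hMc : McGuard F Mc) (hK : recordK₀ F Mc k ≤ K) :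
    side (F.P K).L Mc (k + 1) ∣ (F.P K).sitesPerDir 0 :=
  pow_mul_dvd_sitesPerDir hMc hK

variable {F} in
/-- `q · s = n₀`: the cube count times the cube side is the torus side. [cite: Balaban1987RG1, p.257 (the cubes π_j tile the torus)] -/
theorem domCount_mul_side {Mc k K : ℕ} (hMc : McGuard F Mc) (hK : recordK₀ F Mc k ≤ K) :
    Sect2.domCount (F.P K) Mc (k + 1) * side (F.P K).L Mc (k + 1) = (F.P K).sitesPerDir 0 :=
  domCount_mul_side_eq hMc hK

variable {F} in
/-- `q = n₀ ∕ s` on the tiled range. [cite: Balaban1987RG1, p.257 (bookkeeping)] -/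
theorem domCount_eq_div {Mc k K : ℕ} (hMc : McGuard F Mc) (hK : recordK₀ F Mc k ≤ K) :
    Sect2.domCount (F.P K) Mc (k + 1) = (F.P K).sitesPerDir 0 / side (F.P K).L Mc (k + 1) := by
  rw [← domCount_mul_side hMc hK, Nat.mul_div_cancel _ (side_pos F Mc k K hMc)]

variable {F} in
/-- The next volume has `L` times as many cubes per direction: `q′ = L · q`. [cite: Balaban1987RG1, (1.21) p.264 (bookkeeping)] -/
theorem domCount_succ_vol {Mc k K : ℕ} (hMc : McGuard F Mc) (hK : recordK₀ F Mc k ≤ K) :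
    Sect2.domCount (F.P (K + 1)) Mc (k + 1) = F.L * Sect2.domCount (F.P K) Mc (k + 1) := by
  have hK' : recordK₀ F Mc k ≤ K + 1 := Nat.le_succ_of_le hK
  have h1 := domCount_mul_side hMc hK'
  have h0 := domCount_mul_side hMc hK
  have hs : side (F.P (K + 1)).L Mc (k + 1) = side (F.P K).L Mc (k + 1) := rfl
  rw [hs, sitesPerDir_zero_succ, ← h0, ← mul_assoc] at h1
  exact Nat.eq_of_mul_eq_mul_right (side_pos F Mc k K hMc) h1

variable {F} in
/-- The cube count per direction is EVEN on the tiled range (`q · s = 2L^{m+K}` with `s = L^{k+1+c}` odd). [cite: Balaban1987RG1, (0.1) p.251 (bookkeeping)] -/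
theorem even_domCount {Mc k K : ℕ} (hMc : McGuard F Mc) (hK : recordK₀ F Mc k ≤ K) :
    Even (Sect2.domCount (F.P K) Mc (k + 1)) := by
  have h0 := domCount_mul_side hMc hK
  obtain ⟨c, rfl⟩ := hMc
  have hodd : Odd (side (F.P K).L (F.L ^ c) (k + 1)) := by
    unfold side
    exact (F.hL.1.pow.mul F.hL.1.pow)
  have heven : Even (Sect2.domCount (F.P K) (F.L ^ c) (k + 1) * side (F.P K).L (F.L ^ c) (k + 1)) := by
    rw [h0, T4Family.sitesPerDir_eq]
    exact even_two_mul _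
  exact (Nat.even_mul.1 heven).resolve_right (Nat.not_even_iff_odd.2 hodd)

variable {F} in
/-- `n₀ ∕ 2 = s · (q ∕ 2)` on the tiled range. [cite: Balaban1987RG1, (1.21) p.264 (bookkeeping)] -/
theorem sitesPerDir_div_two {Mc k K : ℕ} (hMc : McGuard F Mc) (hK : recordK₀ F Mc k ≤ K) :
    (F.P K).sitesPerDir 0 / 2 = side (F.P K).L Mc (k + 1) * (Sect2.domCount (F.P K) Mc (k + 1) / 2) := by
  obtain ⟨t, ht⟩ := even_domCount hMc hK
  rw [← domCount_mul_side hMc hK, ht]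
  rw [show (t + t) * side (F.P K).L Mc (k + 1) = 2 * (side (F.P K).L Mc (k + 1) * t) by ring, Nat.mul_div_cancel_left _ two_pos, ← two_mul,
    Nat.mul_div_cancel_left _ two_pos]
/-! ## §2  The fine cube index of a site and membership in the site set of a domain -/

variable {F} in
/-- The cube index of a fine site is below the cube count. [cite: Balaban1987RG1, p.257 (bookkeeping)] -/
theorem val_div_side_lt {Mc k K : ℕ} (hMc : McGuard F Mc) (hK : recordK₀ F Mc k ≤ K) (x : Site (F.P K) 0) (i : Fin (F.P K).d) :
    (x i).val / side (F.P K).L Mc (k + 1) < Sect2.domCount (F.P K) Mc (k + 1) := by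
  rw [domCount_eq_div hMc hK]
  have hs := side_pos F Mc k K hMc
  have hdvd := side_dvd_sitesPerDir hMc hK
  obtain ⟨t, ht⟩ := hdvd
  have hq : (F.P K).sitesPerDir 0 / side (F.P K).L Mc (k + 1) = t := by
    rw [ht, Nat.mul_div_cancel_left _ hs]
  rw [hq]
  exact Nat.div_lt_of_lt_mul (lt_of_lt_of_eq (ZMod.val_lt (x i)) ht)

variable {F} in
/-- The index vector `liftIdx c` of a cube of `𝐃_{k+1}` is a grid index of the `s`-partition. [cite: Balaban1987RG1, p.257 (bookkeeping)] -/
theorem liftIdx_mem_cubeIndices {Mc k K : ℕ} (hMc : McGuard F Mc) (hK : recordK₀ F Mc k ≤ K)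
    (c : TPt (F.P K).d (Sect2.domCount (F.P K) Mc (k + 1))) :
    Sect2.liftIdx (F.P K) c ∈ cubeIndices (F.P K) (side (F.P K).L Mc (k + 1)) := by
  rw [mem_cubeIndices_iff (side_pos F Mc k K hMc) (side_dvd_sitesPerDir hMc hK)]
  intro i
  refine ⟨Int.natCast_nonneg _, ?_⟩
  rw [← domCount_eq_div hMc hK]
  show ((c i).val : ℤ) < _
  exact_mod_cast ZMod.val_lt (c i)

variable {F} in
/-- **A FINE SITE LIES IN THE SITE SET OF `X` IFF ITS CUBE INDEX `⌊x_i ∕ s⌋` (read on the index torus) IS A CUBE OF `X`** (tiled range).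
[cite: Balaban1987RG1, p.257 («every localization domain X is a union of … cubes from π_j»)] -/
theorem mem_domSites_iff {Mc k K : ℕ} (hMc : McGuard F Mc) (hK : recordK₀ F Mc k ≤ K) (X : (recordDomSys F Mc k K).Dom) (x : Site (F.P K) 0) :
    x ∈ Sect2.domSites (F.P K) Mc (k + 1) X ↔
      (fun i => (((x i).val / side (F.P K).L Mc (k + 1) : ℕ) : ZMod (Sect2.domCount (F.P K) Mc (k + 1)))) ∈ (X.1 : Finset _) := by
  have hs := side_pos F Mc k K hMc
  have hdvd := side_dvd_sitesPerDir hMc hK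
  have hlt := val_div_side_lt hMc hK x
  have key : ∀ c : TPt (F.P K).d (Sect2.domCount (F.P K) Mc (k + 1)),
      x ∈ cubeEnl (F.P K) (side (F.P K).L Mc (k + 1)) (Sect2.liftIdx (F.P K) c) 0 ↔
        (fun i => (((x i).val / side (F.P K).L Mc (k + 1) : ℕ) : ZMod (Sect2.domCount (F.P K) Mc (k + 1)))) = c := by
    intro c
    rw [mem_cubeEnl_zero_iff_cubeIdx hs hdvd (liftIdx_mem_cubeIndices hMc hK c)]
    constructor
    · intro h
      funext i
      have hi := congrFun h i
      simp only [cubeIdx, lift, Sect2.liftIdx] at hi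
      rw [← Int.natCast_div] at hi
      have hi' : (x i).val / side (F.P K).L Mc (k + 1) = (c i).val := by exact_mod_cast hi
      rw [hi', ZMod.natCast_zmod_val]
    · intro h
      funext i
      have hi := congrFun h i
      simp only [cubeIdx, lift, Sect2.liftIdx]
      rw [← Int.natCast_div, ← hi, ZMod.val_natCast, Nat.mod_eq_of_lt (hlt i)]
  unfold Sect2.domSites
  simp only [Set.mem_iUnion]
  constructor
  · rintro ⟨c, hc, hx⟩
    rwa [← (key c).1 hx] at hc
  · intro h
    exact ⟨_, h, (key _).2 rfl⟩

/-! ## §3  The CENTRED lift of a fine site lands in the centred lift of its cube (off the seam), and conversely -/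

variable {F} in
/-- An integer congruence read on the index torus: `q ∣ w − a` gives `(a : ZMod q) = (w : ZMod q)`. [folklore] -/
theorem natCast_eq_intCast_of_dvd {q : ℕ} {a : ℕ} {w : ℤ} (h : (q : ℤ) ∣ w - a) : ((a : ℕ) : ZMod q) = ((w : ℤ) : ZMod q) := by
  rw [← Int.cast_natCast, ZMod.intCast_eq_intCast_iff_dvd_sub]
  exact h

variable {F} in
/-- The value of the centred lift of a fine site, LOWER half (`v ≤ n₀∕2`): the lift has the same value `v`. [cite: Balaban1987RG1, (1.21) p.264 (bookkeeping)] -/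
theorem val_liftSiteCtr_of_le {K : ℕ} (x : Site (F.P K) 0) (i : Fin (F.P K).d) (hv : (x i).val ≤ (F.P K).sitesPerDir 0 / 2) :
    (liftSiteCtr F K 0 x i).val = (x i).val := by
  have hL : 1 ≤ F.L := by have := F.hL.2; omega
  have hlt : (x i).val < (F.P (K + 1)).sitesPerDir 0 := by
    rw [sitesPerDir_zero_succ]
    exact (ZMod.val_lt (x i)).trans_le (Nat.le_mul_of_pos_left _ (by omega))
  show ((((x i).valMinAbs : ℤ) : ZMod ((F.P (K + 1)).sitesPerDir 0))).val = (x i).val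
  rw [ZMod.valMinAbs_def_pos, if_pos hv, Int.cast_natCast, ZMod.val_natCast, Nat.mod_eq_of_lt hlt]

variable {F} in
/-- The value of the centred lift of a fine site, UPPER half (`n₀∕2 < v`): the lift has value `(L − 1)·n₀ + v`. [cite: Balaban1987RG1, (1.21) p.264 (bookkeeping)] -/
theorem val_liftSiteCtr_of_lt {K : ℕ} (x : Site (F.P K) 0) (i : Fin (F.P K).d) (hv : (F.P K).sitesPerDir 0 / 2 < (x i).val) :
    (liftSiteCtr F K 0 x i).val = (F.L - 1) * (F.P K).sitesPerDir 0 + (x i).val := by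
  obtain ⟨L', hL'⟩ : ∃ L', F.L = L' + 1 := ⟨F.L - 1, by have := F.hL.2; omega⟩
  have hvlt : (x i).val < (F.P K).sitesPerDir 0 := ZMod.val_lt _
  have hN : (F.P (K + 1)).sitesPerDir 0 = F.L * (F.P K).sitesPerDir 0 := sitesPerDir_zero_succ F K
  have hL1 : F.L - 1 = L' := by omega
  have hlt : (F.L - 1) * (F.P K).sitesPerDir 0 + (x i).val < (F.P (K + 1)).sitesPerDir 0 := by
    rw [hN, hL1, hL', add_mul, one_mul]
    omega
  have hcast : (Int.cast (((x i).val : ℤ) - ((F.P K).sitesPerDir 0 : ℕ)) : ZMod ((F.P (K + 1)).sitesPerDir 0)) =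
      ((((F.L - 1) * (F.P K).sitesPerDir 0 + (x i).val : ℕ) : ℤ) : ZMod ((F.P (K + 1)).sitesPerDir 0)) := by
    rw [ZMod.intCast_eq_intCast_iff_dvd_sub]
    refine ⟨1, ?_⟩
    rw [hN, hL1, hL']
    push_cast
    ring
  show ((((x i).valMinAbs : ℤ)) : ZMod ((F.P (K + 1)).sitesPerDir 0)).val = _
  rw [ZMod.valMinAbs_def_pos, if_neg (not_le.2 hv), hcast, Int.cast_natCast, ZMod.val_natCast, Nat.mod_eq_of_lt hlt]

variable {F} in
/-- Division bookkeeping: `((L−1)·(q·s) + v) ∕ s = (L−1)·q + v ∕ s`. [folklore] -/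
theorem div_side_of_eq {q s L n : ℕ} (hs : 0 < s) (hn : n = q * s) (v : ℕ) : ((L - 1) * n + v) / s = (L - 1) * q + v / s := by
  subst hn
  rw [show (L - 1) * (q * s) + v = v + (L - 1) * q * s by ring, Nat.add_mul_div_right _ _ hs]
  ring

variable {F} in
/-- **OFF THE SEAM, THE CENTRED LIFT OF A FINE SITE LIES IN THE CENTRED LIFT OF ITS CUBE** (one coordinate): if the cube index `a = ⌊v∕s⌋` of the coordinate `v`
is not antipodal (`valMinAbs a ≠ q∕2`), the cube index of the lifted coordinate is the centred lift of `a`. [cite: Balaban1987RG1, (1.21) p.264, p.257] -/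
theorem cube_liftSiteCtr_coord {Mc k K : ℕ} (hMc : McGuard F Mc) (hK : recordK₀ F Mc k ≤ K) (x : Site (F.P K) 0) (i : Fin (F.P K).d)
    (hoff : ((((x i).val / side (F.P K).L Mc (k + 1) : ℕ) : ZMod (Sect2.domCount (F.P K) Mc (k + 1)))).valMinAbs ≠
      ((Sect2.domCount (F.P K) Mc (k + 1) / 2 : ℕ) : ℤ)) :
    (((liftSiteCtr F K 0 x i).val / side (F.P (K + 1)).L Mc (k + 1) : ℕ) : ZMod (Sect2.domCount (F.P (K + 1)) Mc (k + 1))) =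
      liftCubeCtr F Mc k K (fun j => ((((x j).val / side (F.P K).L Mc (k + 1) : ℕ)) : ZMod (Sect2.domCount (F.P K) Mc (k + 1)))) i := by
  have hL : 1 ≤ F.L := by have := F.hL.2; omega
  set s := side (F.P K).L Mc (k + 1) with hsdef
  set q := Sect2.domCount (F.P K) Mc (k + 1) with hqdef
  have hs' : side (F.P (K + 1)).L Mc (k + 1) = s := rfl
  have hs : 0 < s := side_pos F Mc k K hMc
  have hqs : q * s = (F.P K).sitesPerDir 0 := domCount_mul_side hMc hK
  have hq' : Sect2.domCount (F.P (K + 1)) Mc (k + 1) = F.L * q := domCount_succ_vol hMc hK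
  have hhalf : (F.P K).sitesPerDir 0 / 2 = s * (q / 2) := sitesPerDir_div_two hMc hK
  have halt : (x i).val / s < q := val_div_side_lt hMc hK x i
  set a := (x i).val / s with hadef
  show (((liftSiteCtr F K 0 x i).val / s : ℕ) : ZMod (Sect2.domCount (F.P (K + 1)) Mc (k + 1))) = (((a : ZMod q).valMinAbs : ℤ) : ZMod _)
  by_cases hv : (x i).val ≤ (F.P K).sitesPerDir 0 / 2
  · -- lower half: the lift keeps the value, the cube index is `a ≤ q∕2`, not antipodal hence its own centred lift
    have hale : a ≤ q / 2 := by
      rw [hadef]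
      calc (x i).val / s ≤ ((F.P K).sitesPerDir 0 / 2) / s := Nat.div_le_div_right hv
        _ = q / 2 := by rw [hhalf, Nat.mul_div_cancel_left _ hs]
    rw [val_liftSiteCtr_of_le x i hv, ZMod.valMinAbs_natCast_of_le_half hale, Int.cast_natCast]
  · -- upper half: the lift has value `(L−1)n₀ + v`, cube index `(L−1)q + a`; the index `a ≥ q∕2` is not antipodal, so `a > q∕2` and its centred lift is `a − q`
    rw [not_le] at hv
    have hage : q / 2 ≤ a := by
      rw [hadef]
      calc q / 2 = (s * (q / 2)) / s := by rw [Nat.mul_div_cancel_left _ hs]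
        _ ≤ (x i).val / s := Nat.div_le_div_right (by rw [← hhalf]; exact hv.le)
    have hagt : q / 2 < a := by
      refine lt_of_le_of_ne hage fun h => hoff ?_
      rw [← h, ZMod.valMinAbs_natCast_of_le_half le_rfl]
    have hidx : (liftSiteCtr F K 0 x i).val / s = (F.L - 1) * q + a := by
      rw [val_liftSiteCtr_of_lt x i hv, div_side_of_eq hs hqs.symm]
    rw [hidx, ZMod.valMinAbs_natCast_of_half_lt hagt halt, ← Int.cast_natCast, ZMod.intCast_eq_intCast_iff_dvd_sub]
    refine ⟨-1, ?_⟩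
    rw [hq']
    push_cast [Nat.cast_sub hL]
    ring

variable {F} in
/-- **CONVERSELY (one coordinate, ANY site)**: if the cube index of the lifted coordinate is the centred lift of `c i`, then the cube index of the coordinate is `c i`
(the two cases differ from `⌊v∕s⌋` by a multiple of `q`). [cite: Balaban1987RG1, (1.21) p.264 (bookkeeping)] -/
theorem cube_eq_of_liftSiteCtr_coord {Mc k K : ℕ} (hMc : McGuard F Mc) (hK : recordK₀ F Mc k ≤ K) (x : Site (F.P K) 0) (i : Fin (F.P K).d)
    (c : TPt (F.P K).d (Sect2.domCount (F.P K) Mc (k + 1)))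
    (h : (((liftSiteCtr F K 0 x i).val / side (F.P (K + 1)).L Mc (k + 1) : ℕ) : ZMod (Sect2.domCount (F.P (K + 1)) Mc (k + 1))) =
      liftCubeCtr F Mc k K c i) :
    ((((x i).val / side (F.P K).L Mc (k + 1) : ℕ)) : ZMod (Sect2.domCount (F.P K) Mc (k + 1))) = c i := by
  have hL : 1 ≤ F.L := by have := F.hL.2; omega
  have hs' : side (F.P (K + 1)).L Mc (k + 1) = side (F.P K).L Mc (k + 1) := rfl
  have hs : 0 < side (F.P K).L Mc (k + 1) := side_pos F Mc k K hMc
  have hqs : Sect2.domCount (F.P K) Mc (k + 1) * side (F.P K).L Mc (k + 1) = (F.P K).sitesPerDir 0 := domCount_mul_side hMc hK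
  have hq' : Sect2.domCount (F.P (K + 1)) Mc (k + 1) = F.L * Sect2.domCount (F.P K) Mc (k + 1) := domCount_succ_vol hMc hK
  -- `h` read as a divisibility by `q′ = L·q`, hence by `q`
  have h' : ((((liftSiteCtr F K 0 x i).val / side (F.P K).L Mc (k + 1) : ℕ) : ℤ) : ZMod (Sect2.domCount (F.P (K + 1)) Mc (k + 1))) =
      (((c i).valMinAbs : ℤ) : ZMod _) := by
    rw [Int.cast_natCast, ← hs']; exact h
  rw [ZMod.intCast_eq_intCast_iff_dvd_sub, hq'] at h'
  have hdq : (Sect2.domCount (F.P K) Mc (k + 1) : ℤ) ∣ (c i).valMinAbs - (((liftSiteCtr F K 0 x i).val / side (F.P K).L Mc (k + 1) : ℕ) : ℤ) :=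
    (show (Sect2.domCount (F.P K) Mc (k + 1) : ℤ) ∣ ((F.L * Sect2.domCount (F.P K) Mc (k + 1) : ℕ) : ℤ) by
      rw [Nat.cast_mul]; exact dvd_mul_left _ _).trans h'
  rw [← ZMod.coe_valMinAbs (c i)]
  apply natCast_eq_intCast_of_dvd
  by_cases hv : (x i).val ≤ (F.P K).sitesPerDir 0 / 2
  · rwa [val_liftSiteCtr_of_le x i hv] at hdq
  · rw [not_le] at hv
    rw [val_liftSiteCtr_of_lt x i hv, div_side_of_eq hs hqs.symm] at hdq
    have : (c i).valMinAbs - (((F.L - 1) * Sect2.domCount (F.P K) Mc (k + 1) + (x i).val / side (F.P K).L Mc (k + 1) : ℕ) : ℤ) =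
        ((c i).valMinAbs - (((x i).val / side (F.P K).L Mc (k + 1) : ℕ) : ℤ)) +
          (Sect2.domCount (F.P K) Mc (k + 1) : ℤ) * (-((F.L - 1 : ℕ) : ℤ)) := by
      push_cast; ring
    rw [this] at hdq
    exact (dvd_add_left (Dvd.intro _ rfl)).1 hdq

variable {F} in
/-- Vector form: off the seam, the cube of the centred lift of a site IS the centred lift of its cube. [cite: Balaban1987RG1, (1.21) p.264, p.257] -/
theorem cube_liftSiteCtr {Mc k K : ℕ} (hMc : McGuard F Mc) (hK : recordK₀ F Mc k ≤ K) (x : Site (F.P K) 0)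
    (hoff : ¬ OnSeamCtr (fun j => ((((x j).val / side (F.P K).L Mc (k + 1) : ℕ)) : ZMod (Sect2.domCount (F.P K) Mc (k + 1))))) :
    (fun i => (((liftSiteCtr F K 0 x i).val / side (F.P (K + 1)).L Mc (k + 1) : ℕ) : ZMod (Sect2.domCount (F.P (K + 1)) Mc (k + 1)))) =
      liftCubeCtr F Mc k K (fun j => ((((x j).val / side (F.P K).L Mc (k + 1) : ℕ)) : ZMod (Sect2.domCount (F.P K) Mc (k + 1)))) := by
  funext i
  refine cube_liftSiteCtr_coord hMc hK x i fun h => hoff ⟨i, ?_⟩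
  exact h

variable {F} in
/-- Vector form of the converse: the cube of a site is recovered from the cube of its lift. [cite: Balaban1987RG1, (1.21) p.264 (bookkeeping)] -/
theorem cube_eq_of_liftSiteCtr {Mc k K : ℕ} (hMc : McGuard F Mc) (hK : recordK₀ F Mc k ≤ K) (x : Site (F.P K) 0)
    (c : TPt (F.P K).d (Sect2.domCount (F.P K) Mc (k + 1)))
    (h : (fun i => (((liftSiteCtr F K 0 x i).val / side (F.P (K + 1)).L Mc (k + 1) : ℕ) : ZMod (Sect2.domCount (F.P (K + 1)) Mc (k + 1)))) =
      liftCubeCtr F Mc k K c) :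
    (fun j => ((((x j).val / side (F.P K).L Mc (k + 1) : ℕ)) : ZMod (Sect2.domCount (F.P K) Mc (k + 1)))) = c := by
  funext i
  exact cube_eq_of_liftSiteCtr_coord hMc hK x i c (congrFun h i)

/-- On `ZMod n` with `n` even, one step `z ↦ z + 1` moves the minimal representative by `+1` unless `z` is antipodal (`valMinAbs z = n∕2`). [folklore] -/
theorem valMinAbs_add_one_of_ne_half {n : ℕ} [NeZero n] (hn : Even n) (z : ZMod n) (hz : z.valMinAbs ≠ ((n / 2 : ℕ) : ℤ)) :
    (z + 1).valMinAbs = z.valMinAbs + 1 := by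
  have hmem := ZMod.valMinAbs_mem_Ioc z
  obtain ⟨t, ht⟩ := hn
  have hnt : n / 2 = t := by omega
  rw [hnt] at hz
  rw [ZMod.valMinAbs_spec]
  refine ⟨by simp, ?_⟩
  have h1 := hmem.1
  have h2 := hmem.2
  have hne' : (n : ℤ) = 2 * t := by rw [ht]; push_cast; ring
  rw [hne'] at h1 h2 ⊢
  have hne : z.valMinAbs * 2 ≠ 2 * (t : ℤ) := by
    intro h; apply hz; linarith
  constructor
  · linarith
  · omega

/-! ## §4  THE OFF-SEAM LEMMA: the centred lift of a domain off the seam is wall-connected (so `recordDomEmbCtr` takes its first branch) -/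

/-- Off the antipodal layer the centred lift of cube indices carries `c ↦ c + e_i` to `c′ ↦ c′ + e_i`. [cite: Balaban1987RG1, p.257 («two consecutive cubes have a common wall»), (1.21) p.264] -/
theorem liftCubeCtr_update_add_one {Mc k K : ℕ} (c : TPt (F.P K).d (Sect2.domCount (F.P K) Mc (k + 1))) (i : Fin (F.P K).d)
    (hc : ¬ OnSeamCtr c) (hq : Even (Sect2.domCount (F.P K) Mc (k + 1))) :
    liftCubeCtr F Mc k K (Function.update c i (c i + 1)) = Function.update (liftCubeCtr F Mc k K c) i (liftCubeCtr F Mc k K c i + 1) := by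
  have hw : (c i).valMinAbs ≠ ((Sect2.domCount (F.P K) Mc (k + 1) / 2 : ℕ) : ℤ) := fun h => hc ⟨i, h⟩
  have hstep : (c i + 1).valMinAbs = (c i).valMinAbs + 1 := valMinAbs_add_one_of_ne_half hq (c i) hw
  -- read both sides over the index type `Fin (F.P K).d` (definitionally `Fin 4` on either volume)
  show (fun j : Fin (F.P K).d => (((Function.update c i (c i + 1) j).valMinAbs : ℤ) : ZMod (Sect2.domCount (F.P (K + 1)) Mc (k + 1)))) =
    @Function.update (Fin (F.P K).d) (fun _ => ZMod (Sect2.domCount (F.P (K + 1)) Mc (k + 1))) _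
      (fun j => (((c j).valMinAbs : ℤ) : ZMod (Sect2.domCount (F.P (K + 1)) Mc (k + 1)))) i
      ((((c i).valMinAbs : ℤ) : ZMod (Sect2.domCount (F.P (K + 1)) Mc (k + 1))) + 1)
  funext j
  by_cases hj : j = i
  · subst hj
    rw [Function.update_self, Function.update_self, hstep]
    push_cast
    ring
  · rw [Function.update_of_ne hj, Function.update_of_ne hj]

/-- Off the antipodal layer the centred lift preserves wall adjacency. [cite: Balaban1987RG1, p.257, (1.21) p.264] -/
theorem tAdj_liftCubeCtr {Mc k K : ℕ} {c d : TPt (F.P K).d (Sect2.domCount (F.P K) Mc (k + 1))} (hc : ¬ OnSeamCtr c) (hd : ¬ OnSeamCtr d)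
    (hq : Even (Sect2.domCount (F.P K) Mc (k + 1))) (h : TAdj c d) : TAdj (liftCubeCtr F Mc k K c) (liftCubeCtr F Mc k K d) := by
  obtain ⟨i, h | h⟩ := h
  · subst h
    exact ⟨i, Or.inl (liftCubeCtr_update_add_one F c i hc hq)⟩
  · subst h
    exact ⟨i, Or.inr (liftCubeCtr_update_add_one F d i hd hq)⟩

/-- Chains of wall-adjacent cubes inside an off-seam family lift to chains inside the lifted family. [cite: Balaban1987RG1, p.257 (connected families)] -/
theorem tLinked_image_liftCubeCtr {Mc k K : ℕ} {S : Finset (TPt (F.P K).d (Sect2.domCount (F.P K) Mc (k + 1)))} (hS : ∀ c ∈ S, ¬ OnSeamCtr c)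
    (hq : Even (Sect2.domCount (F.P K) Mc (k + 1))) {a b : TPt (F.P K).d (Sect2.domCount (F.P K) Mc (k + 1))} (h : TLinked S a b) :
    TLinked (S.image (liftCubeCtr F Mc k K)) (liftCubeCtr F Mc k K a) (liftCubeCtr F Mc k K b) := by
  classical
  unfold TLinked at h ⊢
  induction h with
  | refl => exact Relation.ReflTransGen.refl
  | tail _ hbc ih =>
    exact ih.tail ⟨Finset.mem_image_of_mem _ hbc.1, Finset.mem_image_of_mem _ hbc.2.1, tAdj_liftCubeCtr F (hS _ hbc.1) (hS _ hbc.2.1) hq hbc.2.2⟩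

variable {F} in
/-- **THE OFF-SEAM LEMMA** (ref-H's nit on 27931 (R3); DEF-1 REMAINING list): for `X ∉ recordWrapCtr` the centred lift of its cube family is a torus localization domain
(non-empty, wall-connected). [cite: Balaban1987RG1, p.257 (localization domains), (1.21) p.264] -/
theorem isTDom_image_liftCubeCtr {Mc k K : ℕ} (hMc : McGuard F Mc) (hK : recordK₀ F Mc k ≤ K) (X : (recordDomSys F Mc k K).Dom)
    (hX : X ∉ recordWrapCtr F Mc k K) : IsTDom ((X.1 : Finset _).image (liftCubeCtr F Mc k K)) := by
  classical
  have hS : ∀ c ∈ (X.1 : Finset _), ¬ OnSeamCtr c := by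
    intro c hc hseam
    exact hX (by simpa [recordWrapCtr] using ⟨c, hc, hseam⟩)
  refine ⟨X.2.1.image _, fun a' ha' b' hb' => ?_⟩
  obtain ⟨a, ha, rfl⟩ := Finset.mem_image.1 ha'
  obtain ⟨b, hb, rfl⟩ := Finset.mem_image.1 hb'
  exact tLinked_image_liftCubeCtr F hS (even_domCount hMc hK) (X.2.2 a ha b hb)

variable {F} in
/-- **Hence `recordDomEmbCtr X` IS the lifted cube family** for `X ∉ recordWrapCtr` (the definition's first branch). [cite: Balaban1987RG1, (1.21) p.264, p.257] -/
theorem recordDomEmbCtr_val {Mc k K : ℕ} (hMc : McGuard F Mc) (hK : recordK₀ F Mc k ≤ K) (X : (recordDomSys F Mc k K).Dom)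
    (hX : X ∉ recordWrapCtr F Mc k K) :
    ((recordDomEmbCtr F Mc k K X).1 : Finset _) = (X.1 : Finset _).image (liftCubeCtr F Mc k K) := by
  classical
  unfold recordDomEmbCtr
  rw [dif_pos (isTDom_image_liftCubeCtr hMc hK X hX)]

end Summit.QuantumFields.YangMills.Theorems.PortU8

end
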